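import Literature.Computability.Complexity.OracleQueryMap
import Literature.Computability.Complexity.OracleClosure
import Literature.Computability.Complexity.HashBricks
import Literature.Computability.Complexity.CircuitEval
import Literature.Computability.Complexity.TruthTableFunctions
import Literature.Computability.Complexity.OracleCompositionMachine
import Literature.Computability.Complexity.StackBricks
import HarnessLib

/-!
# `P/poly` is closed under polynomial-time Turing reductions; function oracles with `P/poly` bit graphs

Trunk `CplxCore`. Two closure properties of `P/poly` (Arora–Barak 2009, Def. 6.5, with Thm. 6.18
`P/poly = P/poly-advice`) that the tree lacked:

* `PRel_ofLanguage_subset_PPoly` — **if `A ∈ P/poly` then `P^A ⊆ P/poly`** (the class of languages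
  decided by polynomial-size circuits is closed under polynomial-time Turing reductions; folklore,
  e.g. Balcázar–Díaz–Gabarró, *Structural Complexity I*, Thm. 5.6-style arguments; Karp–Lipton 1980).
  Proof (advice form): write `A` as a `P` language `L_A` with advice `a` (Thm. 6.18); on inputs of
  length `n` a `P^A` machine `M` (rounds and query lengths `≤ q(n)`) only needs the advice strings
  `a 0, …, a (q n)`, which we supply as ONE advice string, the nested-pair list
  `T n = body [a 0, …, a (q n)]`; the simulating machine `advAlg M q` runs `M` on the first
  component `x` of its input `⟨x, T⟩`, rewriting each query `y` into `⟨y, T[|y|]⟩`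
  (`HashBricks.nthItemFn`, list access in `FP`) and asking the `P`-oracle `L_A` instead of `A`
  (`OracleAlg.mapQuery`, with `capQ`/`comap`/`clock` of `OracleQueryMap.lean` making it total and
  polynomial against every input); `P^{L_A} ⊆ P` (`PRelClass_P_subset_P`), so `L ∈ P/poly-advice = P/poly`.
* `PRel_ofFun_subset_PPoly` — **function oracles**: for `f : {0,1}* → ℕ` with `f x < 2^{r(|x|)}`,
  the binary-answer oracle `Oracle.ofFun f` is computed in `FP` relative to the *bit graph*
  `bitLang f = {⟨x, u⟩ | bit |u| of f x is 1}` (a truth-table transducer, `ttFn_mem_FPRel`: ask the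
  `r(|x|)` bits, strip the high zeros with `norm ∈ FP`), hence `P^f ⊆ P^{bitLang f}`
  (`OracleAlg.PRel_subset_PRel_of_mem_FPRel`) and `P^f ⊆ P/poly` as soon as `bitLang f ∈ P/poly`.

These are the two Boolean closure steps of Bürgisser's Lemma 2.12 (ECCC TR06-113 = Comput.
Complexity 18 (2009); STACS 2007 Lemma 11): "`τ(PER_n) = n^{O(1)}` implies `PP ⊆ P/poly`", where
`PP ⊆ P^{#P} ⊆ P^{PER}` (Valiant) and the permanent's bits get polynomial-size circuits
(`AlgebraicComplexity/PermanentBitsPPoly.lean`).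

## References

* S. Arora, B. Barak, *Computational Complexity: A Modern Approach*, CUP 2009, Def. 6.5,
  Def. 6.16, Thm. 6.18, §3.4 (oracle machines), §17.2 (`FP^{#P}`: answers in binary).
* R. M. Karp, R. J. Lipton, *Some connections between nonuniform and uniform complexity classes*,
  STOC 1980 (advice; `P/poly`).
* R. E. Ladner, N. A. Lynch, A. L. Selman, *A comparison of polynomial time reducibilities*,
  TCS 1 (1975), §3 (truth-table transducers).
* P. Bürgisser, *On defining integers in the counting hierarchy and proving lower bounds in
  algebraic complexity*, ECCC TR06-113 (2006), Lemma 2.12; STACS 2007, LNCS 4393, Lemma 11.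
-/

noncomputable section

namespace Literature.Computability.Complexity

open _root_.Computability Polynomial PRelSigma OracleCompose HashBricks Brick

namespace PPolyTuring

/-! ### The advice table and the query rewriting -/

/-- The advice table for input length `n`: the nested-pair list `body [a 0, a 1, …, a (q n)]` of the
advice strings of the oracle language at all query lengths `≤ q n`. [cite: AroraBarak2009, Def. 6.16] -/
def table (a : ℕ → List Bool) (q : Polynomial ℕ) (n : ℕ) : List Bool :=
  body ((List.range (q.eval n + 1)).map a)

/-- Reading the table: item `|y|` of `table a q n` is `a |y|` for `|y| ≤ q n`. [folklore] -/
theorem nthItemFn_table (a : ℕ → List Bool) (q : Polynomial ℕ) (n : ℕ) {y : List Bool}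
    (hy : y.length ≤ q.eval n) :
    nthItemFn (boolPair y (table a q n)) = a y.length := by
  rw [table, nthItemFn_boolPair, sndF_iterate_body, fstF_body]
  have hlt : y.length < ((List.range (q.eval n + 1)).map a).length := by simp; omega
  rw [List.drop_eq_getElem_cons hlt]
  simp

/-- The length of the table is polynomial: `≤ (q n + 1) (2 b + 2)` if all `|a i| ≤ b` for `i ≤ q n`. [folklore] -/
theorem length_table_le (a : ℕ → List Bool) (q : Polynomial ℕ) (n b : ℕ)
    (hb : ∀ i ≤ q.eval n, (a i).length ≤ b) :
    (table a q n).length ≤ (q.eval n + 1) * (2 * b + 2) := by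
  have h := PRelSigPi.length_body_le (cs := (List.range (q.eval n + 1)).map a) (b := b) fun c hc => by
    obtain ⟨i, hi, rfl⟩ := List.mem_map.1 hc
    exact hb i (by simpa [Nat.lt_succ_iff] using hi)
  simpa [table] using h

/-- **The query rewriting** `⟨w, ⟨as, y⟩⟩ ↦ ⟨y, item |y| of the second component of w⟩`: with
`w = ⟨x, table⟩` the query `y` to `A` becomes the query `⟨y, a |y|⟩` to the advice-taking `P`
language of `A`. [cite: AroraBarak2009, Thm. 6.18] -/
def dAdv : List Bool → List Bool :=
  pairFn (sndP ∘ sndP) (nthItemFn ∘ pairFn (sndP ∘ sndP) (sndP ∘ fstP))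

/-- `dAdv ∈ FP`. [cite: AroraBarak2009, Thm. 6.18] -/
theorem dAdv_mem_FP : dAdv ∈ FP :=
  pairFn_mem_FP (comp_mem_FP sndP_mem_FP sndP_mem_FP)
    (comp_mem_FP nthItemFn_mem_FP
      (pairFn_mem_FP (comp_mem_FP sndP_mem_FP sndP_mem_FP) (comp_mem_FP sndP_mem_FP fstP_mem_FP)))

/-- The value of the rewriting on a well-formed argument. [folklore] -/
theorem dAdv_apply (x T as y : List Bool) :
    dAdv (boolPair (boolPair x T) (boolPair as y)) = boolPair y (nthItemFn (boolPair y T)) := by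
  simp [dAdv, Function.comp_apply]

/-- Iterated second projections do not lengthen. [folklore] -/
theorem length_iterate_sndF_le (k : ℕ) (W : List Bool) : (sndF^[k] W).length ≤ W.length := by
  induction k generalizing W with
  | zero => simp
  | succ k ih =>
    rw [Function.iterate_succ_apply]
    refine (ih _).trans ?_
    have := length_fstF_sndF_le W
    omega

/-- An item of a nested-pair list is no longer than the list: `|nthItemFn ⟨u, W⟩| ≤ |W|`. [folklore] -/
theorem length_nthItemFn_boolPair_le (u W : List Bool) : (nthItemFn (boolPair u W)).length ≤ W.length := by
  rw [nthItemFn_boolPair]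
  have h1 := length_fstF_sndF_le (sndF^[u.length] W)
  have h2 := length_iterate_sndF_le u.length W
  omega

/-! ### The simulating oracle algorithm -/

variable (M : OracleAlg Bool) (q : Polynomial ℕ)

/-- **The advice-driven simulation** of the `P^A` machine `M` (round/query bound `q`): on input
`w = ⟨x, T⟩` run `M` on `x` with queries capped at `q(|x|)`, rewrite each query `y` into
`⟨y, T[|y|]⟩`, and clock the whole at `q(|w|)` rounds. [cite: AroraBarak2009, Thm. 6.18] -/
def advAlg : OracleAlg Bool :=
  (((M.capQ q false).comap fstP).mapQuery dAdv).clock q false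

/-- The language of the simulation against the oracle `O'`. [folklore] -/
def advLang (O' : Oracle) : Language Bool :=
  {w | (advAlg M q).run O' (q.eval w.length + 1) w = some true}

variable {M q}

/-- `advAlg` is polynomial-time when `M` is. [cite: AroraBarak2009, §3.4] -/
theorem isPolyTime_advAlg (hM : M.IsPolyTime encodingBoolBool) : (advAlg M q).IsPolyTime encodingBoolBool :=
  OracleAlg.isPolyTime_clock _
    (OracleAlg.isPolyTime_mapQuery _
      (OracleAlg.isPolyTime_comap _ (OracleAlg.isPolyTime_capQ _ hM q false) fstP_mem_FP) dAdv_mem_FP) q false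

/-- **The queries of `advAlg` are polynomially long** (against any oracle, on any input `w`): each is
`⟨y₀, item⟩` with `|y₀| ≤ q(|w|)` (the cap) and `item` an item of the second component of `w`. [folklore] -/
theorem length_le_of_mem_queries_advAlg (O' : Oracle) {n : ℕ} {w z : List Bool}
    (hz : z ∈ (advAlg M q).queries O' n w) : z.length ≤ 2 * q.eval w.length + w.length + 2 := by
  have hz' := OracleAlg.queries_clock_subset _ q false O' w n hz
  obtain ⟨i, -, hall, rfl⟩ := exists_of_mem_queries _ O' n w _ hz'
  obtain ⟨y, hy⟩ := hall i le_rfl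
  rw [qryOf_eq_of_step_eq hy]
  rw [OracleAlg.mapQuery_step] at hy
  cases hs : ((M.capQ q false).comap fstP).step w
      (trans (((M.capQ q false).comap fstP).mapQuery dAdv) O' w i) with
  | inr b => rw [hs] at hy; cases hy
  | inl y₀ =>
    rw [hs] at hy
    simp only [Sum.inl.injEq] at hy
    rw [← hy]
    have hcap : y₀.length ≤ q.eval w.length := by
      rw [OracleAlg.comap_step] at hs
      refine (OracleAlg.capQ_step_eq_inl hs).trans (TM2Iter.eval_mono _ ?_)
      have := length_boolUnpair_parts_le w
      simp only [fstP]; omega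
    rw [dAdv, pairFn_apply, length_boolPair]
    simp only [Function.comp_apply, sndP_boolPair, fstP_boolPair, pairFn_apply]
    have hitem : (nthItemFn (boolPair y₀ (sndP w))).length ≤ w.length := by
      refine (length_nthItemFn_boolPair_le _ _).trans ?_
      have := length_boolUnpair_parts_le w
      simp only [sndP]; omega
    omega

/-- **`advLang M q O' ∈ P^{O'}`** for `M` polynomial-time: the simulation is polynomial-time,
always answers within `q(|w|) + 1` rounds (the clock), and asks polynomially long queries. [cite: AroraBarak2009, §3.4] -/
theorem advLang_mem_PRel (hM : M.IsPolyTime encodingBoolBool) (O' : Oracle) : advLang M q O' ∈ PRel O' := by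
  refine ⟨advAlg M q, isPolyTime_advAlg hM, 2 * q + X + 3, fun w => ⟨?_, fun z hz => ?_⟩⟩
  · have hsome : ((advAlg M q).run O' (q.eval w.length + 1) w).isSome :=
      OracleAlg.run_clock_isSome _ q false _ w (Nat.lt_succ_self _)
    obtain ⟨b, hb⟩ := Option.isSome_iff_exists.1 hsome
    have hfuel : q.eval w.length + 1 ≤ (2 * q + X + 3 : Polynomial ℕ).eval w.length := by
      simp only [eval_add, eval_mul, eval_X, eval_ofNat]; omega
    rw [OracleAlg.run_mono _ _ _ hfuel hb]
    congr 1
    by_cases hw : w ∈ advLang M q O'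
    · rw [((advLang M q O').mem_iff_boolIndicator w).1 hw]
      have hw' : (advAlg M q).run O' (q.eval w.length + 1) w = some true := hw
      rw [hb] at hw'
      exact Option.some.inj hw'
    · rw [((advLang M q O').notMem_iff_boolIndicator w).1 hw]
      have hw' : (advAlg M q).run O' (q.eval w.length + 1) w ≠ some true := hw
      rw [hb] at hw'
      cases b
      · rfl
      · exact absurd rfl hw'
  · refine (length_le_of_mem_queries_advAlg O' hz).trans ?_
    simp only [eval_add, eval_mul, eval_X, eval_ofNat]; omega

/-- **The rewritten queries are answered correctly on a well-formed input.** With the table of `a`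
in the second component, the `P` language `LA` deciding `A` with advice `a`
(`y ∈ A ↔ ⟨y, a |y|⟩ ∈ LA`) answers the rewritten query `⟨y, a |y|⟩` exactly as `A` answers `y`,
for every capped query `y` (`|y| ≤ q |x|`). [cite: AroraBarak2009, Thm. 6.18] -/
theorem mapAgree_table {A LA : Language Bool} {a : ℕ → List Bool}
    (hAa : ∀ y, y ∈ A ↔ boolPair y (a y.length) ∈ LA) (x : List Bool) :
    OracleAlg.MapAgree ((M.capQ q false).comap fstP) dAdv (Oracle.ofLanguage LA) (Oracle.ofLanguage A)
      (boolPair x (table a q x.length)) := by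
  intro i y _ hstep
  have hcap : y.length ≤ q.eval x.length := by
    rw [OracleAlg.comap_step, fstP_boolPair] at hstep
    exact OracleAlg.capQ_step_eq_inl hstep
  rw [dAdv_apply, nthItemFn_table a q x.length hcap, Oracle.ofLanguage_apply, Oracle.ofLanguage_apply]
  congr 1
  by_cases hy : y ∈ A
  · rw [(A.mem_iff_boolIndicator y).1 hy, (LA.mem_iff_boolIndicator _).1 ((hAa y).1 hy)]
  · rw [(A.notMem_iff_boolIndicator y).1 hy,
      (LA.notMem_iff_boolIndicator _).1 (fun h => hy ((hAa y).2 h))]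

/-- **The simulation is faithful on well-formed inputs**: if `M` with oracle `A` decides `L` within
`q` (rounds and query lengths), then on `⟨x, table⟩` the simulation with oracle `LA` outputs
`[x ∈ L]` within `q(|⟨x, table⟩|) + 1` rounds. [cite: AroraBarak2009, Thm. 6.18] -/
theorem run_advAlg_table {A LA L : Language Bool} {a : ℕ → List Bool}
    (hAa : ∀ y, y ∈ A ↔ boolPair y (a y.length) ∈ LA)
    (hq : ∀ x : List Bool, M.run (Oracle.ofLanguage A) (q.eval x.length) x = some (L.boolIndicator x) ∧
      ∀ y ∈ M.queries (Oracle.ofLanguage A) (q.eval x.length) x, y.length ≤ q.eval x.length)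
    (x : List Bool) :
    (advAlg M q).run (Oracle.ofLanguage LA) (q.eval (boolPair x (table a q x.length)).length + 1)
      (boolPair x (table a q x.length)) = some (L.boolIndicator x) := by
  set w := boolPair x (table a q x.length) with hw
  have hxw : q.eval x.length ≤ q.eval w.length := TM2Iter.eval_mono q (by rw [hw, length_boolPair]; omega)
  -- `M` with more fuel
  have hrun : M.run (Oracle.ofLanguage A) (q.eval w.length) x = some (L.boolIndicator x) :=
    OracleAlg.run_mono _ _ _ hxw (hq x).1
  have hqs : ∀ y ∈ M.queries (Oracle.ofLanguage A) (q.eval w.length) x, y.length ≤ q.eval x.length := by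
    rw [OracleAlg.queries_eq_of_run_eq_some _ _ _ hxw (hq x).1]
    exact (hq x).2
  -- the cap does not act
  have hcapQ : (M.capQ q false).run (Oracle.ofLanguage A) (q.eval w.length) x = some (L.boolIndicator x) := by
    rw [(OracleAlg.run_capQ M q false _ x _ hqs).1, hrun]
  -- reading the input through `fstP` and rewriting the queries
  have hmq : (((M.capQ q false).comap fstP).mapQuery dAdv).run (Oracle.ofLanguage LA) (q.eval w.length) w =
      some (L.boolIndicator x) := by
    rw [OracleAlg.run_mapQuery _ _ _ _ _ (mapAgree_table (M := M) (q := q) hAa x)]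
    change ((M.capQ q false).comap fstP).runAux (Oracle.ofLanguage A) w (q.eval w.length) [] = _
    rw [OracleAlg.runAux_comap, hw, fstP_boolPair, ← hw]
    exact hcapQ
  exact OracleAlg.run_clock_of_run _ q false _ _ hmq (Nat.le_succ _)

end PPolyTuring

open PPolyTuring

/-- **`P/poly` is closed under polynomial-time Turing reductions**: if `A ∈ P/poly` then
`P^A ⊆ P/poly`. (Write `A ∈ P/poly-advice` by Arora–Barak's Thm. 6.18; simulate the `P^A` machine
with the table of the advice strings of all query lengths as advice, asking the `P` language of `A`
instead; `P^P = P`; `P/poly-advice ⊆ P/poly`.) [cite: AroraBarak2009, Thm. 6.18 with Def. 6.5] -/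
theorem PRel_ofLanguage_subset_PPoly {A : Language Bool} (hA : A ∈ PPoly) :
    PRel (Oracle.ofLanguage A) ⊆ PPoly := by
  intro L hL
  obtain ⟨LA, hLA, a, pa, hpa, hAa⟩ := PPoly_subset_polyAdvice_P hA
  obtain ⟨M, hM, q, hq⟩ := hL
  have hL'P : advLang M q (Oracle.ofLanguage LA) ∈ Classes.P :=
    PRelClass_P_subset_P (mem_PRelClass_iff.2 ⟨LA, hLA, advLang_mem_PRel hM _⟩)
  refine polyAdvice_subset_PPoly P_subset_PPoly_holds
    ⟨advLang M q (Oracle.ofLanguage LA), hL'P, fun n => PPolyTuring.table a q n, (q + 1) * (2 * pa.comp q + 2),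
      fun n => ?_, fun x => ?_⟩
  · refine (length_table_le a q n (pa.eval (q.eval n)) fun i hi => (hpa i).trans (TM2Iter.eval_mono pa hi)).trans ?_
    simp only [eval_mul, eval_add, eval_one, eval_ofNat, eval_comp]
    exact le_rfl
  · change x ∈ L ↔ (advAlg M q).run (Oracle.ofLanguage LA)
      (q.eval (boolPair x (PPolyTuring.table a q x.length)).length + 1) (boolPair x (PPolyTuring.table a q x.length)) = some true
    rw [run_advAlg_table hAa hq x, Option.some.injEq]
    exact ⟨fun h => (L.mem_iff_boolIndicator x).1 h, fun h => by
      by_contra hx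
      rw [(L.notMem_iff_boolIndicator x).1 hx] at h
      exact Bool.false_ne_true h⟩

/-- Equivalently: `P/poly` is closed under `≤ᵀₚ` (`PolyTimeTuringReducible`). [cite: AroraBarak2009, Thm. 6.18 with Def. 6.5] -/
theorem mem_PPoly_of_polyTimeTuringReducible {L A : Language Bool} (h : PolyTimeTuringReducible L A) (hA : A ∈ PPoly) :
    L ∈ PPoly :=
  PRel_ofLanguage_subset_PPoly hA h

/-- Hence `P^{P/poly} ⊆ P/poly` (`PRelClass`). [cite: AroraBarak2009, Thm. 6.18 with Def. 6.5] -/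
theorem PRelClass_PPoly_subset_PPoly : PRelClass PPoly ⊆ PPoly := by
  intro L hL
  obtain ⟨A, hA, hLA⟩ := mem_PRelClass_iff.1 hL
  exact PRel_ofLanguage_subset_PPoly hA hLA

/-! ### Function oracles: `P^f ⊆ P^{bit graph of f} ⊆ P/poly` -/

/-- **The bit graph of a function** `f : {0,1}* → ℕ`: `⟨x, u⟩ ∈ bitLang f` iff the bit of weight
`2^{|u|}` of `f x` is `1` (the position in unary, so that the truth-table queries `⟨x, 1ⁱ⟩` of
`ttFn` read the bits in order). [cite: AroraBarak2009, §17.2] -/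
def bitLang (f : List Bool → ℕ) : Language Bool :=
  {z | (f (fstP z)).testBit (sndP z).length = true}

/-- Membership of a pair in the bit graph. [folklore] -/
theorem boolPair_mem_bitLang_iff (f : List Bool → ℕ) (x u : List Bool) :
    boolPair x u ∈ bitLang f ↔ (f x).testBit u.length = true := by
  change (f (fstP (boolPair x u))).testBit (sndP (boolPair x u)).length = true ↔ _
  rw [fstP_boolPair, sndP_boolPair]

/-- **Reading a number from its low `r` bits**: `bitsToNat [m₀, …, m_{r-1}] = m mod 2^r`. [folklore] -/
theorem bitsToNat_map_testBit (m r : ℕ) :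
    bitsToNat ((List.range r).map fun i => m.testBit i) = m % 2 ^ r := by
  induction r with
  | zero => simp [Nat.mod_one]
  | succ r ih =>
    rw [List.range_succ, List.map_append, List.map_singleton, bitsToNat_append, ih, List.length_map,
      List.length_range, bitsToNat_cons, bitsToNat_nil, mul_zero, add_zero, Nat.mod_pow_succ,
      Nat.toNat_testBit]

/-- The answer bits of the identity queries against the bit graph are the bits of `f x`. [folklore] -/
theorem ttBits_id_bitLang (f : List Bool → ℕ) (x : List Bool) (r : ℕ) :
    ttBits id (bitLang f) x r = (List.range r).map fun i => (f x).testBit i := by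
  simp only [ttBits, id]
  refine List.map_congr_left fun i _ => ?_
  by_cases h : (f x).testBit i = true
  · rw [(Set.mem_iff_boolIndicator _ _).1 ((boolPair_mem_bitLang_iff f x _).2 (by simpa using h)), h]
  · rw [(Set.notMem_iff_boolIndicator _ _).1 (fun h' => h (by simpa using (boolPair_mem_bitLang_iff f x _).1 h'))]
    exact (Bool.eq_false_iff.2 h).symm

/-- **The binary-answer oracle of `f` is a truth-table transducer over its bit graph**: ask the bits
`0, …, r(|x|) - 1` (queries `⟨x, 1ⁱ⟩`, i.e. `Q = id`) and output the normal form (`norm`, high zeros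
stripped) of the answer string, which is `encodeNat (f x)` when `f x < 2^{r(|x|)}`. [cite: AroraBarak2009, §17.2] -/
theorem ofFun_eq_ttFn (f : List Bool → ℕ) (r : Polynomial ℕ) (hf : ∀ x, f x < 2 ^ r.eval x.length) :
    Oracle.ofFun f = ttFn id r (norm ∘ sndP) (bitLang f) := by
  funext x
  rw [Oracle.ofFun_apply, ttFn_apply, Function.comp_apply, sndP_boolPair, ttBits_id_bitLang,
    norm_eq_encodeNat, bitsToNat_map_testBit, Nat.mod_eq_of_lt (hf x)]

/-- **`Oracle.ofFun f ∈ FP^{bitLang f}`** for `f` of polynomial bit length. [cite: AroraBarak2009, §17.2] -/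
theorem ofFun_mem_FPRel_bitLang (f : List Bool → ℕ) (r : Polynomial ℕ)
    (hf : ∀ x, f x < 2 ^ r.eval x.length) :
    Oracle.ofFun f ∈ FPRel (Oracle.ofLanguage (bitLang f)) := by
  rw [ofFun_eq_ttFn f r hf]
  exact ttFn_mem_FPRel id_mem_FP (comp_mem_FP Brick.norm_mem_FP sndP_mem_FP) _

/-- Hence **`P^f ⊆ P^{bitLang f}`** (oracle composition, `OracleCompositionMachine.lean`). [cite: AroraBarak2009, §17.2 with §3.4] -/
theorem PRel_ofFun_subset_PRel_bitLang (f : List Bool → ℕ) (r : Polynomial ℕ)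
    (hf : ∀ x, f x < 2 ^ r.eval x.length) :
    PRel (Oracle.ofFun f) ⊆ PRel (Oracle.ofLanguage (bitLang f)) :=
  OracleAlg.PRel_subset_PRel_of_mem_FPRel (ofFun_mem_FPRel_bitLang f r hf)

/-- **Function oracles with `P/poly` bit graphs**: if `f x < 2^{r(|x|)}` and `bitLang f ∈ P/poly`
then `P^f ⊆ P/poly`. [cite: AroraBarak2009, Thm. 6.18 with §17.2] -/
theorem PRel_ofFun_subset_PPoly {f : List Bool → ℕ} (r : Polynomial ℕ)
    (hf : ∀ x, f x < 2 ^ r.eval x.length) (hbit : bitLang f ∈ PPoly) :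
    PRel (Oracle.ofFun f) ⊆ PPoly :=
  (PRel_ofFun_subset_PRel_bitLang f r hf).trans (PRel_ofLanguage_subset_PPoly hbit)

end Literature.Computability.Complexity
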